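import Summits.AtomisticToContinuum.Crystallization.Theorems.ChartedZeroExcessLayeredLatticeLiouvilleZZZYRCX

/-!
# Charted zero-excess layered-lattice Liouville — ZZZYRCZ: the θ⁰ near reader, PROOF KIT (translations, lookup, counting lemma, bounds)

Cell `decomp-a2c`, lens 2, generation 100.  Line (D) TAIL-DEBIT of `UniformEquilStabilityAt`, NEAR class of the three-way cover
(ZZZYRCX/RCY).  This file and its sequel ZZZYRCZK PROVE the reader contract `ThetaReaderNear` of ZZZYRCX (`thetaReaderNear_holds`,
in RCZK): valid chord data for the ideal class `(lo, hi]` of a word, word-indexed majorants `TR / TN` of the exact ideal tables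
`thetaR0 / thetaN0`, the box comparisons `IdealLengthCmp wd λ μ` / `IdealAngleCmp wd K η` and the scalar side conditions
`μ²·P9max ≤ 9ϱ²`, `μ²·lo ≤ 9ϱ²`, `0 ≤ ϱ` imply that the path system READ OFF the data is a path system on the far ideal-near pairs and
that the scheme is dominated there by `(1+α)λ⁻⁸·TR ∘ key` and `(1+α⁻¹)λ⁻⁸·(K·TN + η·TR) ∘ key`.  Here, the kit:

§1 TRANSLATIONS of pairs (`shiftPairW`) leave `n9W`, `d18W`, `sinSq0` and the piece key invariant (layer shift a multiple of the
   period); a pair is the translate of its base representative; a translation is determined by the image of one site; `0 ≤ n9W`;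
§2 a far pair has ideal length `> lo` and `> 0`, hence (completeness of valid data at the BASED representative) its lookup SUCCEEDS,
   and the path read off the data is the translated chord path (`piece_dataZ`), with the datum's endpoints;
§3 ★ the COUNTING LEMMA `sum_pieces_le_table` (abstract, any types): if every `x ∈ X` looks up a datum, incidences `(x, i)` with
   piece `y` inject into incidences `(datum, i)` carrying the key of `y`, so a sum over the pieces equal to `y` is at most the
   key-indexed table (non-negative entries);
§4 the per-incidence COEFFICIENT BOUNDS: `cos² ≤ 1`, `a₋(r) ≤ 7/r⁸ ≤ 45927/(λ⁸·n9⁴)` from `λ²·n9 ≤ 9r²` (`45927 = 7·9⁴`), and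
   `sin²_actual ≤ K·sin²_ideal + η` transported to the datum: `schemeCoefR ≤ (1+α)λ⁻⁸·coefR0`,
   `schemeCoefN ≤ (1+α⁻¹)λ⁻⁸·(K·coefN0 + η·coefR0)`, and the N-table entries are `≥ 0`.

Theorem file (1 def `shiftPairW`, 26 theorems); imports ZZZYRCX only; no instance / notation / option; 0 sorry. [g100]
-/


namespace Summit.AtomisticToContinuum.Crystallization.Theorems.ChartedZeroExcessLayeredLatticeLiouville

open scoped BigOperators RealInnerProductSpace
open Summit.AtomisticToContinuum.Crystallization.Theorems.ChartedPlanarOrderRigidityDoor (E3)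

/-! ### §1 translations -/

/-- translate both sites of a pair by an in-plane lattice vector and a layer shift. [g100] -/
def shiftPairW (γ : Cell 2) (d : ℤ) (q : (Cell 2 × ℤ) × (Cell 2 × ℤ)) : (Cell 2 × ℤ) × (Cell 2 × ℤ) :=
  (shiftSiteW γ d q.1, shiftSiteW γ d q.2)

/-- `n9W` is invariant under a pair translation whose layer shift is a multiple of the period. [g100] -/
theorem n9W_shiftPairW (wd : List ℤ) (γ : Cell 2) (k : ℤ) (q : (Cell 2 × ℤ) × (Cell 2 × ℤ)) :
    n9W wd (shiftPairW γ ((wd.length : ℤ) * k) q) = n9W wd q :=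
  n9W_shift wd γ k q

/-- `d18W` is invariant under a common pair translation (layer shift a multiple of the period). [g100] -/
theorem d18W_shiftPairW (wd : List ℤ) (γ : Cell 2) (k : ℤ) (u v : (Cell 2 × ℤ) × (Cell 2 × ℤ)) :
    d18W wd (shiftPairW γ ((wd.length : ℤ) * k) u) (shiftPairW γ ((wd.length : ℤ) * k) v) = d18W wd u v := by
  simp only [d18W, refW0, refW1, shiftPairW, shiftSiteW, regW_add_mul, Pi.add_apply]
  ring

/-- the ideal `sin²` is invariant under a common pair translation. [g100] -/
theorem sinSq0_shiftPairW (wd : List ℤ) (γ : Cell 2) (k : ℤ) (u v : (Cell 2 × ℤ) × (Cell 2 × ℤ)) :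
    sinSq0 wd (shiftPairW γ ((wd.length : ℤ) * k) u) (shiftPairW γ ((wd.length : ℤ) * k) v) = sinSq0 wd u v := by
  unfold sinSq0
  rw [d18W_shiftPairW, n9W_shiftPairW, n9W_shiftPairW]

/-- the piece key is invariant under a pair translation (layer shift a multiple of the period). [g100] -/
theorem pieceKeyW_shiftPairW (wd : List ℤ) (γ : Cell 2) (k : ℤ) (q : (Cell 2 × ℤ) × (Cell 2 × ℤ)) :
    pieceKeyW wd.length (shiftPairW γ ((wd.length : ℤ) * k) q) = pieceKeyW wd.length q := by
  simp only [pieceKeyW, shiftPairW, shiftSiteW, Pi.add_apply, Int.add_mul_emod_self_left, Prod.mk.injEq]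
  refine ⟨trivial, ?_, ?_, ?_⟩ <;> ring

/-- a pair is the translate of its base representative by `(x.1.1, baseShift p x)`. [g100] -/
theorem shiftPairW_toBase (p : ℕ) (x : (Cell 2 × ℤ) × (Cell 2 × ℤ)) : shiftPairW x.1.1 (baseShift p x) (toBase p x) = x := by
  obtain ⟨⟨γ, m⟩, ⟨γ', m'⟩⟩ := x
  simp only [shiftPairW, toBase, shiftSiteW, neg_add_cancel_right]

/-- a site translation is determined by the image of one site. [g100] -/
theorem shiftSiteW_inj {γ γ' : Cell 2} {d d' : ℤ} {s : Cell 2 × ℤ} (h : shiftSiteW γ d s = shiftSiteW γ' d' s) :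
    γ = γ' ∧ d = d' := by
  simp only [shiftSiteW, Prod.mk.injEq, add_right_inj] at h
  exact h

/-- the base representative is based: `(toBase p x).1 = (0, m)` with `0 ≤ m < p`. [g100] -/
theorem toBase_based (wd : List ℤ) (hp : 0 < wd.length) (x : (Cell 2 × ℤ) × (Cell 2 × ℤ)) :
    (toBase wd.length x).1.1 = 0 ∧ 0 ≤ (toBase wd.length x).1.2 ∧ (toBase wd.length x).1.2 < (wd.length : ℤ) := by
  have hp' : (0 : ℤ) < wd.length := by exact_mod_cast hp
  refine ⟨?_, ?_, ?_⟩
  · simp only [toBase, shiftSiteW, add_neg_cancel]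
  · show 0 ≤ x.1.2 + -baseShift wd.length x
    unfold baseShift
    have := Int.emod_nonneg x.1.2 hp'.ne'
    linarith
  · show x.1.2 + -baseShift wd.length x < wd.length
    unfold baseShift
    have := Int.emod_lt_of_pos x.1.2 hp'
    linarith

/-- `0 ≤ n9W` (`a² + ab + b² ≥ 0`). [g100] -/
theorem n9W_nonneg (wd : List ℤ) (x : (Cell 2 × ℤ) × (Cell 2 × ℤ)) : 0 ≤ n9W wd x := by
  unfold n9W
  nlinarith [sq_nonneg (2 * (refW0 wd x.2 - refW0 wd x.1) + (refW1 wd x.2 - refW1 wd x.1)),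
    sq_nonneg (refW1 wd x.2 - refW1 wd x.1), sq_nonneg (x.2.2 - x.1.2)]

/-! ### §2 far pairs are listed; the path read off the data -/

/-- a far pair has POSITIVE ideal length (`0 ≤ ϱ < ‖e‖`, `9‖e‖² ≤ μ²·n9`). [g100] -/
theorem n9W_pos_of_far {wd : List ℤ} {lam mu ϱ : ℝ} {a b : E3} {w : ℤ → E3} (hϱ : 0 ≤ ϱ) (hL : IdealLengthCmp wd lam mu a b w)
    {x : (Cell 2 × ℤ) × (Cell 2 × ℤ)} (hx : ϱ < ‖bondVec a b w x‖) : 0 < n9W wd x := by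
  have h2 := (hL x).2
  have hr : 0 < ‖bondVec a b w x‖ := hϱ.trans_lt hx
  rcases lt_or_ge 0 (n9W wd x) with h | h
  · exact h
  · exfalso
    have hc : (n9W wd x : ℝ) ≤ 0 := by exact_mod_cast h
    nlinarith [sq_nonneg mu, mul_le_mul_of_nonneg_left hc (sq_nonneg mu)]

/-- a far pair has ideal length above the far cut `lo` (`μ²·lo ≤ 9ϱ² < 9‖e‖² ≤ μ²·n9`). [g100] -/
theorem lo_lt_n9W_of_far {wd : List ℤ} {lam mu ϱ : ℝ} {lo : ℤ} {a b : E3} {w : ℤ → E3} (hϱ : 0 ≤ ϱ)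
    (hL : IdealLengthCmp wd lam mu a b w) (hlo : mu ^ 2 * (lo : ℝ) ≤ 9 * ϱ ^ 2)
    {x : (Cell 2 × ℤ) × (Cell 2 × ℤ)} (hx : ϱ < ‖bondVec a b w x‖) : lo < n9W wd x := by
  have h2 := (hL x).2
  have hϱ2 : ϱ ^ 2 < ‖bondVec a b w x‖ ^ 2 := by nlinarith [norm_nonneg (bondVec a b w x)]
  rcases lt_or_ge lo (n9W wd x) with h | h
  · exact h
  · exfalso
    have hc : (n9W wd x : ℝ) ≤ lo := by exact_mod_cast h
    nlinarith [sq_nonneg mu, mul_le_mul_of_nonneg_left hc (sq_nonneg mu)]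

/-- the datum found by the lookup is based at `toBase p x` and is a member of the data. [g100] -/
theorem lookup_sound {p : ℕ} {cd : List ChordDatum} {x : (Cell 2 × ℤ) × (Cell 2 × ℤ)} {c : ChordDatum}
    (h : dataLookup p cd x = some c) : c ∈ cd ∧ c.1 = toBase p x := by
  refine ⟨List.mem_of_find?_eq_some h, ?_⟩
  have := List.find?_some h
  simpa using this

/-- ★ a far ideal-near pair is LISTED: the data lookup succeeds (completeness of valid data at the base representative). [g100] -/
theorem lookup_of_near {wd : List ℤ} {lo hi P9max : ℤ} {cd : List ChordDatum} (hp : 0 < wd.length)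
    (hV : ChordDataValid wd lo hi P9max cd) {x : (Cell 2 × ℤ) × (Cell 2 × ℤ)} (hlo : lo < n9W wd x) (hhi : IdealNear wd hi x) :
    ∃ c ∈ cd, dataLookup wd.length cd x = some c := by
  obtain ⟨h0, hm, hlt⟩ := toBase_based wd hp x
  have hlo' : lo < n9W wd (toBase wd.length x) := by rwa [n9W_toBase]
  obtain ⟨c, hc, hcx⟩ := hV.2.2 _ h0 hm hlt hlo' hhi
  have hsome : (dataLookup wd.length cd x).isSome = true := by
    unfold dataLookup
    rw [List.find?_isSome]
    exact ⟨c, hc, by simpa using hcx⟩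
  obtain ⟨c', hc'⟩ := Option.isSome_iff_exists.mp hsome
  exact ⟨c', (lookup_sound hc').1, hc'⟩

/-- number of pieces read off a successful lookup. [g100] -/
theorem dataNp_of_lookup {p : ℕ} {cd : List ChordDatum} {x : (Cell 2 × ℤ) × (Cell 2 × ℤ)} {c : ChordDatum}
    (h : dataLookup p cd x = some c) : dataNp p cd x = chordNp c := by
  simp only [dataNp, h]

/-- path nodes read off a successful lookup. [g100] -/
theorem dataZ_of_lookup {p : ℕ} {cd : List ChordDatum} {x : (Cell 2 × ℤ) × (Cell 2 × ℤ)} {c : ChordDatum}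
    (h : dataLookup p cd x = some c) (i : ℕ) : dataZ p cd x i = shiftSiteW x.1.1 (baseShift p x) ((chordNodes c).getD i c.1.2) := by
  simp only [dataZ, h]

/-- ★ the pieces read off the data are the translated chord pieces. [g100] -/
theorem piece_dataZ {p : ℕ} {cd : List ChordDatum} {x : (Cell 2 × ℤ) × (Cell 2 × ℤ)} {c : ChordDatum}
    (h : dataLookup p cd x = some c) (i : ℕ) : piece (dataZ p cd) x i = shiftPairW x.1.1 (baseShift p x) (chordPiece c i) := by
  simp only [piece, dataZ_of_lookup h, shiftPairW, chordPiece]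

/-- first node of a datum. [g100] -/
theorem chordNodes_getD_zero (c : ChordDatum) : (chordNodes c).getD 0 c.1.2 = c.1.1 := List.getD_cons_zero

/-- last node of a datum. [g100] -/
theorem chordNodes_getD_np (c : ChordDatum) : (chordNodes c).getD (chordNp c) c.1.2 = c.1.2 := by
  unfold chordNodes chordNp
  rw [List.getD_cons_succ, List.getD_append_right _ _ _ _ le_rfl, Nat.sub_self, List.getD_cons_zero]

/-! ### §3 the counting lemma -/

/-- ★ COUNTING LEMMA.  Every `x ∈ X` looks up a datum `c ∈ T` with `np x = npC c`; an incidence `(x, i)` with property `P x i` has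
`f x i ≤ g c i` and `Q c i`; `g ≥ 0` where `Q`; and `(x, i) ↦ (c, i)` is injective on `P`.  Then the `P`-restricted sum of `f` over the
incidences of `X` is at most the `Q`-restricted sum of `g` over the incidences of `T`. [g100] -/
theorem sum_pieces_le_table {A C : Type*} [DecidableEq A] [DecidableEq C] (X : Finset A) (T : Finset C) (np : A → ℕ)
    (npC : C → ℕ) (look : A → Option C) (P : A → ℕ → Prop) [∀ x i, Decidable (P x i)] (Q : C → ℕ → Prop)
    [∀ c i, Decidable (Q c i)] (f : A → ℕ → ℝ) (g : C → ℕ → ℝ)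
    (hlook : ∀ x ∈ X, ∃ c ∈ T, look x = some c ∧ np x = npC c)
    (hfg : ∀ x ∈ X, ∀ c i, look x = some c → i < npC c → P x i → f x i ≤ g c i ∧ Q c i)
    (hg : ∀ c ∈ T, ∀ i < npC c, Q c i → 0 ≤ g c i)
    (hinj : ∀ x ∈ X, ∀ x' ∈ X, ∀ c i, look x = some c → look x' = some c → P x i → P x' i → x = x') :
    (∑ x ∈ X, ∑ i ∈ Finset.range (np x), if P x i then f x i else 0) ≤
      ∑ c ∈ T, ∑ i ∈ Finset.range (npC c), if Q c i then g c i else 0 := by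
  have h1 : ∀ x ∈ X, (∑ i ∈ Finset.range (np x), if P x i then f x i else 0) ≤
      ∑ c ∈ T, ∑ i ∈ Finset.range (npC c), if look x = some c ∧ P x i then g c i else 0 := by
    intro x hx
    obtain ⟨c, hcT, hxc, hnp⟩ := hlook x hx
    have hsum : (∑ c' ∈ T, ∑ i ∈ Finset.range (npC c'), if look x = some c' ∧ P x i then g c' i else 0) =
        ∑ i ∈ Finset.range (npC c), if P x i then g c i else 0 := by
      have hval : ∀ c' ∈ T, (∑ i ∈ Finset.range (npC c'), if look x = some c' ∧ P x i then g c' i else 0) =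
          if c = c' then ∑ i ∈ Finset.range (npC c'), (if P x i then g c' i else 0) else 0 := by
        intro c' _
        by_cases hcc : c = c'
        · subst hcc
          simp only [hxc, true_and, if_true]
        · have hne : ¬ look x = some c' := by rw [hxc, Option.some.injEq]; exact hcc
          simp only [hne, false_and, if_false, Finset.sum_const_zero, hcc]
      rw [Finset.sum_congr rfl hval, Finset.sum_ite_eq T c, if_pos hcT]
    rw [hsum, hnp]
    refine Finset.sum_le_sum fun i hi => ?_
    by_cases hP : P x i
    · rw [if_pos hP, if_pos hP]
      exact (hfg x hx c i hxc (Finset.mem_range.mp hi) hP).1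
    · rw [if_neg hP, if_neg hP]
  refine (Finset.sum_le_sum h1).trans ?_
  rw [Finset.sum_comm]
  refine Finset.sum_le_sum fun c hcT => ?_
  rw [Finset.sum_comm]
  refine Finset.sum_le_sum fun i hi => ?_
  rw [← Finset.sum_filter, Finset.sum_const, nsmul_eq_mul]
  have hcard : (X.filter fun x => look x = some c ∧ P x i).card ≤ 1 :=
    Finset.card_le_one.mpr fun x hx x' hx' => by
      rw [Finset.mem_filter] at hx hx'
      exact hinj x hx.1 x' hx'.1 c i hx.2.1 hx'.2.1 hx.2.2 hx'.2.2
  by_cases hne : (X.filter fun x => look x = some c ∧ P x i).Nonempty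
  · obtain ⟨x, hx⟩ := hne
    rw [Finset.mem_filter] at hx
    obtain ⟨_, hQ⟩ := hfg x hx.1 c i hx.2.1 (Finset.mem_range.mp hi) hx.2.2
    rw [if_pos hQ]
    have hg0 := hg c hcT i (Finset.mem_range.mp hi) hQ
    have hc1 : ((X.filter fun x => look x = some c ∧ P x i).card : ℝ) ≤ 1 := by exact_mod_cast hcard
    nlinarith
  · rw [Finset.not_nonempty_iff_eq_empty.mp hne, Finset.card_empty, Nat.cast_zero, zero_mul]
    by_cases hQ : Q c i
    · rw [if_pos hQ]; exact hg c hcT i (Finset.mem_range.mp hi) hQ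
    · rw [if_neg hQ]

/-! ### §4 per-incidence coefficient bounds -/

/-- `7/r⁸ ≤ 45927/(λ⁸·n9⁴)` from `λ²·n9 ≤ 9r²` (`45927 = 7·9⁴`). [g100] -/
theorem seven_div_pow_eight_le {lam r : ℝ} {n9 : ℤ} (hlam : 0 < lam) (hn : 0 < n9) (h : lam ^ 2 * (n9 : ℝ) ≤ 9 * r ^ 2) :
    7 / r ^ 8 ≤ 45927 / (lam ^ 8 * (n9 : ℝ) ^ 4) := by
  have hn' : (0 : ℝ) < n9 := by exact_mod_cast hn
  have hpos : 0 < lam ^ 2 * (n9 : ℝ) / 9 := by positivity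
  have hle : lam ^ 2 * (n9 : ℝ) / 9 ≤ r ^ 2 := by linarith
  have h4 : (lam ^ 2 * (n9 : ℝ) / 9) ^ 4 ≤ (r ^ 2) ^ 4 := pow_le_pow_left₀ hpos.le hle 4
  have hr8 : (lam ^ 2 * (n9 : ℝ) / 9) ^ 4 ≤ r ^ 8 := by rw [← pow_mul] at h4; exact h4
  calc 7 / r ^ 8 ≤ 7 / (lam ^ 2 * (n9 : ℝ) / 9) ^ 4 := div_le_div_of_nonneg_left (by norm_num) (pow_pos hpos 4) hr8
    _ = 45927 / (lam ^ 8 * (n9 : ℝ) ^ 4) := by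
      have h1 : lam ≠ 0 := hlam.ne'
      have h2 : (n9 : ℝ) ≠ 0 := hn'.ne'
      field_simp
      ring

/-- `0 ≤ sin²_actual` (Cauchy–Schwarz). [g100] -/
theorem sinSqPair_nonneg (a b : E3) (w : ℤ → E3) (x q : (Cell 2 × ℤ) × (Cell 2 × ℤ)) : 0 ≤ sinSqPair a b w x q := by
  unfold sinSqPair
  rw [sub_nonneg]
  refine div_le_one_of_le₀ ?_ (mul_nonneg (sq_nonneg _) (sq_nonneg _))
  have h := abs_real_inner_le_norm (bondVec a b w x) (bondVec a b w q)
  calc ⟪bondVec a b w x, bondVec a b w q⟫ ^ 2 = |⟪bondVec a b w x, bondVec a b w q⟫| ^ 2 := (sq_abs _).symm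
    _ ≤ (‖bondVec a b w x‖ * ‖bondVec a b w q‖) ^ 2 := pow_le_pow_left₀ (abs_nonneg _) h 2
    _ = ‖bondVec a b w x‖ ^ 2 * ‖bondVec a b w q‖ ^ 2 := by ring

/-- the scheme's `1 − cos²` of piece `i` is `sin²_actual` of the pair and its piece. [g100] -/
theorem one_sub_cosSq (a b : E3) (w : ℤ → E3) (z : (Cell 2 × ℤ) × (Cell 2 × ℤ) → ℕ → Cell 2 × ℤ)
    (x : (Cell 2 × ℤ) × (Cell 2 × ℤ)) (i : ℕ) : 1 - cosSq a b w z x i = sinSqPair a b w x (piece z x i) := by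
  simp only [cosSq, sinSqPair]

/-- `coefN0` through the ideal `sin²`. [g100] -/
theorem coefN0_eq (wd : List ℤ) (c : ChordDatum) (i : ℕ) :
    coefN0 wd c i = (chordNp c : ℝ) * 45927 * sinSq0 wd c.1 (chordPiece c i) / (n9W wd c.1 : ℝ) ^ 4 := by
  simp only [coefN0, sinSq0]

/-- the common facts of a far pair with a datum: `n9W x = n9W c.1 > 0` and `a₋(‖e_x‖) ≤ 45927/(λ⁸·n9W(c.1)⁴)`. [g100] -/
theorem far_datum_facts {wd : List ℤ} {cd : List ChordDatum} {lam mu ϱ : ℝ} {a b : E3} {w : ℤ → E3} (hϱ : 0 ≤ ϱ)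
    (hlam : 0 < lam) (hL : IdealLengthCmp wd lam mu a b w) {x : (Cell 2 × ℤ) × (Cell 2 × ℤ)} (hx : ϱ < ‖bondVec a b w x‖)
    {c : ChordDatum} (hcx : dataLookup wd.length cd x = some c) :
    n9W wd x = n9W wd c.1 ∧ 0 < n9W wd c.1 ∧ aMinus ‖bondVec a b w x‖ ≤ 45927 / (lam ^ 8 * (n9W wd c.1 : ℝ) ^ 4) := by
  have hn9 : n9W wd x = n9W wd c.1 := by rw [(lookup_sound hcx).2, n9W_toBase]
  have hpos : 0 < n9W wd c.1 := by rw [← hn9]; exact n9W_pos_of_far hϱ hL hx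
  refine ⟨hn9, hpos, (aMinus_le_div _).trans (seven_div_pow_eight_le hlam hpos ?_)⟩
  rw [← hn9]
  exact (hL x).1

/-- ★ STRETCH coefficient of an incidence of a far listed pair: `≤ (1+α)·λ⁻⁸·coefR0`. [g100] -/
theorem schemeCoefR_le_coefR0 {wd : List ℤ} {cd : List ChordDatum} {ϱ α lam mu : ℝ} {a b : E3} {w : ℤ → E3} (hϱ : 0 ≤ ϱ)
    (hα : 0 < α) (hlam : 0 < lam) (hL : IdealLengthCmp wd lam mu a b w) {x : (Cell 2 × ℤ) × (Cell 2 × ℤ)}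
    (hx : ϱ < ‖bondVec a b w x‖) {c : ChordDatum} (hcx : dataLookup wd.length cd x = some c) (i : ℕ) :
    schemeCoefR α a b w (dataNp wd.length cd) (dataZ wd.length cd) x i ≤ (1 + α) * (lam ^ 8)⁻¹ * coefR0 wd c := by
  obtain ⟨_, hpos, hb⟩ := far_datum_facts hϱ hlam hL hx hcx
  have hpos' : (0 : ℝ) < n9W wd c.1 := by exact_mod_cast hpos
  unfold schemeCoefR coefR0
  rw [dataNp_of_lookup hcx]
  calc (1 + α) * (chordNp c : ℝ) * cosSq a b w (dataZ wd.length cd) x i * aMinus ‖bondVec a b w x‖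
      ≤ (1 + α) * (chordNp c : ℝ) * 1 * (45927 / (lam ^ 8 * (n9W wd c.1 : ℝ) ^ 4)) :=
        mul_le_mul (mul_le_mul_of_nonneg_left (cosSq_le_one _ _ _ _ _ _) (by positivity)) hb (aMinus_nonneg _) (by positivity)
    _ = (1 + α) * (lam ^ 8)⁻¹ * ((chordNp c : ℝ) * 45927 / (n9W wd c.1 : ℝ) ^ 4) := by
        have h1 : lam ≠ 0 := hlam.ne'
        have h2 : (n9W wd c.1 : ℝ) ≠ 0 := hpos'.ne'
        field_simp

/-- ★ NORM coefficient of an incidence of a far listed pair: `≤ (1+α⁻¹)·λ⁻⁸·(K·coefN0 + η·coefR0)`. [g100] -/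
theorem schemeCoefN_le_coefN0 {wd : List ℤ} {lo hi P9max : ℤ} {cd : List ChordDatum} {ϱ α lam mu K η : ℝ} {a b : E3}
    {w : ℤ → E3} (hϱ : 0 ≤ ϱ) (hα : 0 < α) (hlam : 0 < lam) (hL : IdealLengthCmp wd lam mu a b w)
    (hA : IdealAngleCmp wd K η a b w) (hV : ChordDataValid wd lo hi P9max cd) {x : (Cell 2 × ℤ) × (Cell 2 × ℤ)}
    (hx : ϱ < ‖bondVec a b w x‖) {c : ChordDatum} (hcx : dataLookup wd.length cd x = some c) {i : ℕ} (hi : i < chordNp c) :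
    schemeCoefN α a b w (dataNp wd.length cd) (dataZ wd.length cd) x i ≤
      (1 + α⁻¹) * (lam ^ 8)⁻¹ * (K * coefN0 wd c i + η * coefR0 wd c) := by
  obtain ⟨hn9, hpos, hb⟩ := far_datum_facts hϱ hlam hL hx hcx
  have hpos' : (0 : ℝ) < n9W wd c.1 := by exact_mod_cast hpos
  obtain ⟨hmem, hc1⟩ := lookup_sound hcx
  have hq : 0 < n9W wd (chordPiece c i) := ((hV.1 c hmem).2.2.2.2.2 i hi).1
  have hqn : n9W wd (shiftPairW x.1.1 (baseShift wd.length x) (chordPiece c i)) = n9W wd (chordPiece c i) := by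
    rw [baseShift_eq]; exact n9W_shiftPairW wd _ _ _
  have hs : sinSqPair a b w x (shiftPairW x.1.1 (baseShift wd.length x) (chordPiece c i)) ≤
      K * sinSq0 wd c.1 (chordPiece c i) + η := by
    have h := hA x (shiftPairW x.1.1 (baseShift wd.length x) (chordPiece c i)) (by rw [hn9]; exact hpos) (by rw [hqn]; exact hq)
    have e1 : x = shiftPairW x.1.1 (baseShift wd.length x) c.1 := by rw [hc1, shiftPairW_toBase]
    have hs0 : sinSq0 wd x (shiftPairW x.1.1 (baseShift wd.length x) (chordPiece c i)) = sinSq0 wd c.1 (chordPiece c i) := by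
      calc sinSq0 wd x (shiftPairW x.1.1 (baseShift wd.length x) (chordPiece c i))
          = sinSq0 wd (shiftPairW x.1.1 (baseShift wd.length x) c.1)
              (shiftPairW x.1.1 (baseShift wd.length x) (chordPiece c i)) := by rw [← e1]
        _ = sinSq0 wd c.1 (chordPiece c i) := by rw [baseShift_eq]; exact sinSq0_shiftPairW wd _ _ _ _
    rw [hs0] at h
    exact h
  have hs' : 0 ≤ sinSqPair a b w x (shiftPairW x.1.1 (baseShift wd.length x) (chordPiece c i)) := sinSqPair_nonneg _ _ _ _ _
  unfold schemeCoefN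
  rw [coefN0_eq, dataNp_of_lookup hcx, one_sub_cosSq, piece_dataZ hcx]
  unfold coefR0
  calc (1 + α⁻¹) * (chordNp c : ℝ) * sinSqPair a b w x (shiftPairW x.1.1 (baseShift wd.length x) (chordPiece c i)) *
        aMinus ‖bondVec a b w x‖
      ≤ (1 + α⁻¹) * (chordNp c : ℝ) * (K * sinSq0 wd c.1 (chordPiece c i) + η) * (45927 / (lam ^ 8 * (n9W wd c.1 : ℝ) ^ 4)) :=
        mul_le_mul (mul_le_mul_of_nonneg_left hs (by positivity)) hb (aMinus_nonneg _)
          (mul_nonneg (by positivity) (hs'.trans hs))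
    _ = (1 + α⁻¹) * (lam ^ 8)⁻¹ * (K * ((chordNp c : ℝ) * 45927 * sinSq0 wd c.1 (chordPiece c i) / (n9W wd c.1 : ℝ) ^ 4) +
          η * ((chordNp c : ℝ) * 45927 / (n9W wd c.1 : ℝ) ^ 4)) := by
        have h1 : lam ≠ 0 := hlam.ne'
        have h2 : (n9W wd c.1 : ℝ) ≠ 0 := hpos'.ne'
        field_simp

/-- the N-table entries are non-negative: `K·coefN0 + η·coefR0 ≥ 0` (via the angle comparison at the datum itself, or `n9 = 0`;
`K, η ≥ 0` not needed). [g100] -/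
theorem coefN_table_nonneg {wd : List ℤ} {lo hi P9max : ℤ} {cd : List ChordDatum} {K η : ℝ} {a b : E3} {w : ℤ → E3}
    (hA : IdealAngleCmp wd K η a b w) (hV : ChordDataValid wd lo hi P9max cd) {c : ChordDatum}
    (hc : c ∈ cd) {i : ℕ} (hi : i < chordNp c) : 0 ≤ K * coefN0 wd c i + η * coefR0 wd c := by
  rw [coefN0_eq]
  unfold coefR0
  rcases (n9W_nonneg wd c.1).eq_or_lt with h0 | hpos
  · rw [← h0]
    simp
  · have hq : 0 < n9W wd (chordPiece c i) := ((hV.1 c hc).2.2.2.2.2 i hi).1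
    have hs := (sinSqPair_nonneg a b w c.1 (chordPiece c i)).trans (hA c.1 (chordPiece c i) hpos hq)
    have hpos' : (0 : ℝ) < n9W wd c.1 := by exact_mod_cast hpos
    have : K * ((chordNp c : ℝ) * 45927 * sinSq0 wd c.1 (chordPiece c i) / (n9W wd c.1 : ℝ) ^ 4) +
        η * ((chordNp c : ℝ) * 45927 / (n9W wd c.1 : ℝ) ^ 4) =
        (chordNp c : ℝ) * 45927 / (n9W wd c.1 : ℝ) ^ 4 * (K * sinSq0 wd c.1 (chordPiece c i) + η) := by ring
    rw [this]
    exact mul_nonneg (by positivity) hs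

end Summit.AtomisticToContinuum.Crystallization.Theorems.ChartedZeroExcessLayeredLatticeLiouville
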